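import Summits.ResolutionOfSingularities.ResolutionOfSingularities.Theorems.WeightedInvariantHypersurfaceLocalGameEFTPointMoveDrop
import Summits.ResolutionOfSingularities.ResolutionOfSingularities.Theorems.WeightedInvariantHypersurfaceLocalGameEFTDimTwoNewtonFace
import Summits.ResolutionOfSingularities.ResolutionOfSingularities.Theorems.WeightedInvariantHypersurfaceLocalGameEFTDimTwoSubSlope
import HarnessLib

/-!
# The e.f.t. local weighted game (H2a′), dim-2 rung II: the two winning point moves at a level `b`

Topic: `Summits/ResolutionOfSingularities/ResolutionOfSingularities/Theorems`. Helper for the door item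
`HypersurfaceCentreConstruction` (statement `stmt-ResolutionOfSingularities-19897`, route `WeightedInvariant`);
kernel K7 (assembly), part 2 of 3, of the dim-2 design memo `L/res-type-098-w43/EFT-DIM2-DESIGN.md` v2
(ORDER (o13) of `res-L1-w43-plan-1`), for THE named rank `ι = iotaOrd` (res-type-073, p502169).

[OURS · L1 W4.3] Replaces the role of NO printed item; NOT a statement of the manuscript
[claim: Hironaka2017, status: under-review]. AI work, weaker than expert review.

## Content (namespace `LocalGameEFTDimTwo`; the drop AT THE MOVE LEVEL, as res-L1-w43-plan-1 RULING gen 9 #4 (3) asks)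

`S` regular local with regular system of parameters `(x, y)` (`spanFinrank 𝔪 = 2`), `f ∈ 𝔪^ν ∖ 𝔪^{ν+1}` (`ν ≥ 1`),
`𝒥_b(n) = weightedMonomialIdeal ![x, y] ![1, b] n` (K5). «DROP for the move `(x, y), (1, b)`» below means the
successor conjunct of `LocalWeightedDropEFT` for that move with `ι = iotaOrd` and target value `ν`: at every prime
`𝔫 ∋ t⁻¹` of `B = S[t⁻¹, 𝒥ₙtⁿ]` over `𝔪B`, off the vertex, and every `t⁻¹`-saturated `g` with `f = t⁻ᵃ g` singular at
`𝔫`, `iotaOrd B_𝔫 g < ν`.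

* **`pointMove_iotaOrd_lt_of_prepared_of_not_mem`** (memo case C, «sub-integral first slope»): if the position is
  PREPARED at level `b ≥ 1` (`f - c y^ν ∈ 𝒥_b(bν+1)`, `c` a unit) and does NOT reach level `b + 1`
  (`f ∉ 𝒥_{b+1}((b+1)ν)`), the move `(x, y), (1, b)` DROPS — res-type-092's `LocalGameEFTNewton.prepared_face` /
  `exists_weight_lt_of_not_mem` feed res-type-013's K3b-iii `LocalGameEFTPointMove.subSlope_pointMove_iotaOrd_lt`
  (p512335; counting engine res-type-025's `LocalGameEFTSubSlope.sum_monomial_not_mem_pow`).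
* **`pointMove_iotaOrd_lt_of_not_steepenable`** (memo case D, «integral slope, face not a `ν`-th power»): if
  `f ∈ 𝒥_b(bν)` with `b ≥ 2` and NO steepening `y ↦ y - λ̃ x^b` prepares `f` at level `b` (no unit `c` and `λ̃` with
  `f - c (y - λ̃ x^b)^ν ∈ 𝒥_b(bν+1)`), the move `(x, y), (1, b)` DROPS — the `(1, b)`-face polynomial `P ∈ κ[s]` read on
  a unit expansion (`rho_transform_eq_face`) has `P_ν ≠ 0` and is not `c (s - λ)^ν` (else K5d
  `LocalGameEFTSteepening.sub_mul_steepen_pow_mem_of_face` would steepen), so res-type-078's K4a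
  `LocalGameEFTFace.algebraMap_face_notMem_pow` and K7a `LocalGameEFTPointMove.pointMove_iotaOrd_lt_of_face` apply.

## References

* J. Włodarczyk, *Functorial resolution by torus actions*, arXiv:2203.03090, §2.3.9, §3.3, Lemma 4.1.7. [Wlodarczyk2022]
* H. Matsumura, *Commutative Ring Theory*, Thm. 14.2, Thm. 16.2. [Matsumura1987]
-/

noncomputable section

open IsLocalRing Literature.AlgebraicGeometry.Resolution Polynomial
open Summit.ResolutionOfSingularities.ResolutionOfSingularities.Cruxes.HypersurfaceCentreConstruction.LocalEngine
  (iotaOrd)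

set_option linter.dupNamespace false -- mandated namespace of this single-conjunct summit

namespace Summit.ResolutionOfSingularities.ResolutionOfSingularities.Theorems

namespace LocalGameEFTDimTwo

variable {S : Type} [CommRing S]

/-! ### Exponent bookkeeping -/

/-- The positivity of the weights `(1, b)`, `b ≥ 1`. [folklore] -/
theorem weights_pos {b : ℕ} (hb : 1 ≤ b) : ∀ i, 0 < (![1, b] : Fin 2 → ℕ) i :=
  Fin.forall_fin_two.2 ⟨Nat.one_pos, hb⟩

/-! ### The `(1, b)`-face polynomial read on a unit expansion -/

section FacePolynomial

variable [IsRegularLocalRing S] (hd : (maximalIdeal S).spanFinrank = 2) {x y : S}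
  (hxy : Ideal.span {x, y} = maximalIdeal S)

/-- **The face polynomial of the transform.** For a monomial expansion `f = Σ_{α∈Δ} a_α x^{α₀} y^{α₁} + r` all of whose
exponents have `(1, b)`-weight `≥ bν` (`r ∈ 𝔪^N`, `N > bν`), the image of K3a's transform in the exceptional chart
`κ[X₀, X₁]` is the `(1, b)`-homogenisation `Σ_{k ≤ ν} P_k X₀^{b(ν-k)} X₁^k` of the FACE POLYNOMIAL
`P = Σ_{k ≤ ν} ā'_k s^k`, `a'_k = a_{(b(ν-k), k)}` (or `0`). [cite: Wlodarczyk2022, Lemma 4.1.7] -/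
theorem rho_transform_eq_face {b : ℕ} (hb : 1 ≤ b) {ν : ℕ} (Δ : Finset (Fin 2 → ℕ)) (a : (Fin 2 → ℕ) → S) {N : ℕ}
    (hN : 0 < N) {r : S} (hr : r ∈ (maximalIdeal S) ^ N)
    (hge : ∀ α ∈ Δ, b * ν ≤ ∑ i, (![1, b] : Fin 2 → ℕ) i * α i) (hνN : b * ν < N) :
    LocalGameEFTPointMove.rho ![x, y] ![1, b] (LocalGameEFTNewton.span_range_vecCons_eq hxy) hd (weights_pos hb)
        (LocalGameEFTPointMove.transform ![x, y] ![1, b] (LocalGameEFTNewton.span_range_vecCons_eq hxy)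
          (weights_pos hb) Δ a (b * ν) hN hr) =
      ∑ k ∈ Finset.range (ν + 1),
        MvPolynomial.C ((∑ j ∈ Finset.range (ν + 1), Polynomial.monomial j
            (Ideal.Quotient.mk (Ideal.span (Set.range ![x, y]))
              (if (![b * (ν - j), j] : Fin 2 → ℕ) ∈ Δ then a ![b * (ν - j), j] else 0))).coeff k) *
          MvPolynomial.X 0 ^ (b * (ν - k)) * MvPolynomial.X 1 ^ k := by
  classical
  rw [LocalGameEFTPointMove.rho_transform _ _ _ hd _ Δ a (b * ν) hN hr hge hνN]
  -- coefficients of the face polynomial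
  have hPcoeff : ∀ k ∈ Finset.range (ν + 1),
      (∑ j ∈ Finset.range (ν + 1), Polynomial.monomial j
        (Ideal.Quotient.mk (Ideal.span (Set.range ![x, y]))
          (if (![b * (ν - j), j] : Fin 2 → ℕ) ∈ Δ then a ![b * (ν - j), j] else 0))).coeff k =
        Ideal.Quotient.mk (Ideal.span (Set.range ![x, y]))
          (if (![b * (ν - k), k] : Fin 2 → ℕ) ∈ Δ then a ![b * (ν - k), k] else 0) := fun k hk => by
    rw [Polynomial.finsetSum_coeff]
    simp_rw [Polynomial.coeff_monomial]
    rw [Finset.sum_eq_single k (fun k' _ hk' => if_neg hk') (fun h => absurd hk h), if_pos rfl]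
  symm
  rw [Finset.sum_congr rfl fun k hk => by rw [hPcoeff k hk]]
  -- drop the vanishing terms, then re-index by `k ↦ (b(ν-k), k)`
  rw [← Finset.sum_filter_of_ne (p := fun k => (![b * (ν - k), k] : Fin 2 → ℕ) ∈ Δ)
    (fun k _ hk => by by_contra h; exact hk (by rw [if_neg h, map_zero, map_zero, zero_mul, zero_mul]))]
  refine Finset.sum_bij (fun k _ => (![b * (ν - k), k] : Fin 2 → ℕ)) ?_ ?_ ?_ ?_
  · intro k hk
    obtain ⟨hkr, hkΔ⟩ := Finset.mem_filter.mp hk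
    refine Finset.mem_filter.mpr ⟨hkΔ, ?_⟩
    have hkν : k ≤ ν := Nat.lt_succ_iff.mp (Finset.mem_range.mp hkr)
    rw [LocalGameEFTNewton.weight_two]
    simp only [Matrix.cons_val_zero, Matrix.cons_val_one]
    rw [Nat.mul_sub, Nat.sub_add_cancel (Nat.mul_le_mul_left b hkν)]
  · intro k₁ hk₁ k₂ hk₂ h
    have := congrFun h 1
    simpa using this
  · intro α hα
    obtain ⟨hαΔ, hαeq⟩ := Finset.mem_filter.mp hα
    rw [LocalGameEFTNewton.weight_two] at hαeq
    have hα1 : α 1 ≤ ν := by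
      by_contra hlt
      have : b * (ν + 1) ≤ b * α 1 := Nat.mul_le_mul_left b (by omega)
      rw [Nat.mul_succ] at this
      omega
    have hα0 : α 0 = b * (ν - α 1) := by rw [Nat.mul_sub]; omega
    have hαvec : (![b * (ν - α 1), α 1] : Fin 2 → ℕ) = α := by
      ext i; fin_cases i <;> simp [hα0]
    exact ⟨α 1, Finset.mem_filter.mpr ⟨Finset.mem_range.mpr (Nat.lt_succ_of_le hα1), by rw [hαvec]; exact hαΔ⟩,
      hαvec⟩
  · intro k hk
    obtain ⟨-, hkΔ⟩ := Finset.mem_filter.mp hk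
    rw [if_pos hkΔ, Fin.prod_univ_two]
    simp only [Matrix.cons_val_zero, Matrix.cons_val_one, mul_assoc]

end FacePolynomial

/-! ### The two winning point moves -/

section Drops

variable [IsRegularLocalRing S] (hd : (maximalIdeal S).spanFinrank = 2) {x y : S}
  (hxy : Ideal.span {x, y} = maximalIdeal S) {f : S} {ν : ℕ} (hν1 : 1 ≤ ν)
  (hfν : f ∈ maximalIdeal S ^ ν) (hfν' : f ∉ maximalIdeal S ^ (ν + 1))

include hd hxy hν1 hfν hfν'

omit hν1 hfν hfν' in
/-- **Case C (sub-integral first slope): the move `(x, y), (1, b)` drops.** `S` regular local with regular system of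
parameters `(x, y)`, `ν ≥ 1`; if `f - c y^ν ∈ 𝒥_b(bν+1)` with `c` a unit and `b ≥ 1` (prepared at level `b`) and
`f ∉ 𝒥_{b+1}((b+1)ν)` (level `b + 1` is not reached), then at every prime `𝔫 ∋ t⁻¹` of `B = S[t⁻¹, 𝒥ₙtⁿ]`
(`𝒥 = 𝒥_b`) over `𝔪B`, off the vertex, every saturated transform `g` of `f` has `iotaOrd B_𝔫 g < ν`
(res-type-013's K3b-iii on res-type-092's unit expansion). [OURS · L1 W4.3 · K7, case C] -/
theorem pointMove_iotaOrd_lt_of_prepared_of_not_mem {b : ℕ} (hb : 1 ≤ b) {c : S} (hc : IsUnit c)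
    (hprep : f - c * y ^ ν ∈ weightedMonomialIdeal ![x, y] ![1, b] (b * ν + 1))
    (hnot : f ∉ weightedMonomialIdeal ![x, y] ![1, b + 1] ((b + 1) * ν)) :
    ∀ (𝔫 : Ideal (extReesAlgebra (weightedMonomialIdeal ![x, y] ![1, b]))) [𝔫.IsPrime],
      extReesAlgebra.tInv (weightedMonomialIdeal ![x, y] ![1, b]) ∈ 𝔫 →
      (maximalIdeal S).map (algebraMap S (extReesAlgebra (weightedMonomialIdeal ![x, y] ![1, b]))) ≤ 𝔫 →
      ¬ (extReesAlgebra.vertexIdeal (weightedMonomialIdeal ![x, y] ![1, b]) ≤ 𝔫) →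
      ∀ (a' : ℕ) (g : extReesAlgebra (weightedMonomialIdeal ![x, y] ![1, b])),
        algebraMap S (extReesAlgebra (weightedMonomialIdeal ![x, y] ![1, b])) f =
          extReesAlgebra.tInv (weightedMonomialIdeal ![x, y] ![1, b]) ^ a' * g →
        ¬ (extReesAlgebra.tInv (weightedMonomialIdeal ![x, y] ![1, b]) ∣ g) →
        algebraMap (extReesAlgebra (weightedMonomialIdeal ![x, y] ![1, b])) (Localization.AtPrime 𝔫) g ∈
          (maximalIdeal (Localization.AtPrime 𝔫)) ^ 2 →
        iotaOrd (Localization.AtPrime 𝔫)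
          (algebraMap (extReesAlgebra (weightedMonomialIdeal ![x, y] ![1, b])) (Localization.AtPrime 𝔫) g) < ν := by
  classical
  have hu : Ideal.span (Set.range ![x, y]) = maximalIdeal S := LocalGameEFTNewton.span_range_vecCons_eq hxy
  have hw : ∀ i, 0 < (![1, b] : Fin 2 → ℕ) i := weights_pos hb
  have hw' : ∀ i, 0 < (![1, b + 1] : Fin 2 → ℕ) i := weights_pos (Nat.le_succ_of_le hb)
  have hdimS : ringKrullDim S = (2 : ℕ) := by
    rw [← IsRegularLocalRing.spanFinrank_maximalIdeal, hd]
  -- the unit expansion to order `(b+1)ν + 1`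
  have hN : 0 < (b + 1) * ν + 1 := Nat.succ_pos _
  obtain ⟨Δ, a, hunit, -, hr⟩ := LocalGameEFTNewton.exists_unitExpansion ![x, y] hu f ((b + 1) * ν + 1)
  have hbN : b * ν + 1 ≤ (b + 1) * ν + 1 := by nlinarith
  obtain ⟨he0, hface0⟩ := LocalGameEFTNewton.prepared_face hdimS hxy hb hc hprep hunit hr hbN
  have hm : ∀ α ∈ Δ, b * ν ≤ ∑ i, (![1, b] : Fin 2 → ℕ) i * α i := fun α hα => by
    rw [LocalGameEFTNewton.weight_two]
    by_cases hα0 : α = ![0, ν]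
    · subst hα0; simp
    · exact Nat.le_of_succ_le (hface0 α hα hα0)
  have hα₀0 : (![0, ν] : Fin 2 → ℕ) 0 = 0 := by simp
  have hα₀m : ∑ i, (![1, b] : Fin 2 → ℕ) i * (![0, ν] : Fin 2 → ℕ) i = b * ν := by
    rw [LocalGameEFTNewton.weight_two]; simp
  have hface : ∀ α ∈ Δ, α ≠ ![0, ν] → b * ν < ∑ i, (![1, b] : Fin 2 → ℕ) i * α i := fun α hα hne => by
    rw [LocalGameEFTNewton.weight_two]
    exact hface0 α hα hne
  have hlt : ∃ α ∈ Δ, α 1 + ∑ i, (![1, b] : Fin 2 → ℕ) i * α i < ν + b * ν := by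
    obtain ⟨α, hα, hlt⟩ := LocalGameEFTNewton.exists_weight_lt_of_not_mem ![x, y] hu ![1, b + 1] hw' hr
      (Nat.le_succ _) hnot
    refine ⟨α, hα, ?_⟩
    rw [LocalGameEFTNewton.weight_two] at hlt ⊢
    have e1 : (b + 1) * α 1 = b * α 1 + α 1 := by ring
    have e2 : (b + 1) * ν = b * ν + ν := by ring
    rw [e1, e2] at hlt
    omega
  have hf : f = ∑ α ∈ Δ, a α * ∏ i, ![x, y] i ^ α i + (f - ∑ α ∈ Δ, a α * ∏ i, ![x, y] i ^ α i) :=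
    (add_sub_cancel _ f).symm
  have hNν : ν + b * ν ≤ (b + 1) * ν + 1 := by nlinarith
  exact LocalGameEFTPointMove.subSlope_pointMove_iotaOrd_lt ![x, y] ![1, b] hu hd hw Δ a hunit (b * ν) hN hr hm hf
    ![0, ν] he0 hα₀0 hα₀m hface ν hlt hNν

/-- **Case D (integral slope, face not a `ν`-th power): the move `(x, y), (1, b)` drops.** `S` regular local with
regular system of parameters `(x, y)`, `f ∈ 𝔪^ν ∖ 𝔪^{ν+1}`, `ν ≥ 1`; if `f ∈ 𝒥_b(bν)` for some `b ≥ 2` and `f`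
cannot be prepared at level `b` by a steepening (no unit `c` and `λ̃ ∈ S` with `f - c (y - λ̃ x^b)^ν ∈ 𝒥_b(bν+1)`),
then at every prime `𝔫 ∋ t⁻¹` of `B = S[t⁻¹, 𝒥ₙtⁿ]` over `𝔪B`, off the vertex, every saturated transform `g` of `f`
has `iotaOrd B_𝔫 g < ν` (the face polynomial has a non-zero top coefficient and is not `c (s - λ)^ν`; K4a + K7a).
[OURS · L1 W4.3 · K7, case D] -/
theorem pointMove_iotaOrd_lt_of_not_steepenable {b : ℕ} (hb : 2 ≤ b)
    (hfJ : f ∈ weightedMonomialIdeal ![x, y] ![1, b] (b * ν))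
    (hst : ¬ ∃ c lam : S, IsUnit c ∧
      f - c * (y - lam * x ^ b) ^ ν ∈ weightedMonomialIdeal ![x, y] ![1, b] (b * ν + 1)) :
    ∀ (𝔫 : Ideal (extReesAlgebra (weightedMonomialIdeal ![x, y] ![1, b]))) [𝔫.IsPrime],
      extReesAlgebra.tInv (weightedMonomialIdeal ![x, y] ![1, b]) ∈ 𝔫 →
      (maximalIdeal S).map (algebraMap S (extReesAlgebra (weightedMonomialIdeal ![x, y] ![1, b]))) ≤ 𝔫 →
      ¬ (extReesAlgebra.vertexIdeal (weightedMonomialIdeal ![x, y] ![1, b]) ≤ 𝔫) →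
      ∀ (a' : ℕ) (g : extReesAlgebra (weightedMonomialIdeal ![x, y] ![1, b])),
        algebraMap S (extReesAlgebra (weightedMonomialIdeal ![x, y] ![1, b])) f =
          extReesAlgebra.tInv (weightedMonomialIdeal ![x, y] ![1, b]) ^ a' * g →
        ¬ (extReesAlgebra.tInv (weightedMonomialIdeal ![x, y] ![1, b]) ∣ g) →
        algebraMap (extReesAlgebra (weightedMonomialIdeal ![x, y] ![1, b])) (Localization.AtPrime 𝔫) g ∈
          (maximalIdeal (Localization.AtPrime 𝔫)) ^ 2 →
        iotaOrd (Localization.AtPrime 𝔫)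
          (algebraMap (extReesAlgebra (weightedMonomialIdeal ![x, y] ![1, b])) (Localization.AtPrime 𝔫) g) < ν := by
  classical
  have hb1 : 1 ≤ b := by omega
  have hu : Ideal.span (Set.range ![x, y]) = maximalIdeal S := LocalGameEFTNewton.span_range_vecCons_eq hxy
  have hw : ∀ i, 0 < (![1, b] : Fin 2 → ℕ) i := weights_pos hb1
  have hdimS : ringKrullDim S = (2 : ℕ) := by
    rw [← IsRegularLocalRing.spanFinrank_maximalIdeal, hd]
  set I : Ideal S := Ideal.span (Set.range ![x, y]) with hI
  haveI hImax : I.IsMaximal := by rw [hu]; exact IsLocalRing.maximalIdeal.isMaximal S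
  -- the unit expansion to order `bν + 1`
  have hN : 0 < b * ν + 1 := Nat.succ_pos _
  obtain ⟨Δ, a, hunit, -, hr⟩ := LocalGameEFTNewton.exists_unitExpansion ![x, y] hu f (b * ν + 1)
  have hge : ∀ α ∈ Δ, b * ν ≤ ∑ i, (![1, b] : Fin 2 → ℕ) i * α i :=
    LocalGameEFTNewton.le_weight_of_mem_weightedMonomialIdeal ![x, y] hu hdimS ![1, b] hw hunit hr hfJ (Nat.le_succ _)
  have hge' : ∀ α ∈ Δ, b * ν ≤ α 0 + b * α 1 := fun α hα => by
    rw [← LocalGameEFTNewton.weight_two]; exact hge α hα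
  -- the vertex `(0, ν)` is an exponent (the tangent cone is `ā y^ν` as `b ≥ 2`)
  have hνN : ν < b * ν + 1 := by nlinarith
  obtain ⟨-, α₀, hα₀, hα₀ν⟩ :=
    LocalGameEFTNewton.exists_degree_eq_of_not_mem_pow ![x, y] hu hdimS hunit hr hfν hfν' hνN
  rw [Fin.sum_univ_two] at hα₀ν
  have hα₀1 : α₀ 1 = ν := by
    by_contra hne
    have hk : 0 < ν - α₀ 1 := by omega
    have h1 := hge' α₀ hα₀
    have e : b * ν = b * (ν - α₀ 1) + b * α₀ 1 := by rw [← Nat.mul_add, Nat.sub_add_cancel (by omega)]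
    have h3 : b * (ν - α₀ 1) ≤ 1 * (ν - α₀ 1) := by omega
    have := Nat.le_of_mul_le_mul_right h3 hk
    omega
  have he0 : (![0, ν] : Fin 2 → ℕ) ∈ Δ := by
    have hαvec : (![0, ν] : Fin 2 → ℕ) = α₀ := by
      ext i; fin_cases i
      · simp; omega
      · simp [hα₀1]
    rw [hαvec]; exact hα₀
  -- the face coefficients `a'` and the face polynomial `P ∈ κ[s]`
  set a' : ℕ → S := fun j => if (![b * (ν - j), j] : Fin 2 → ℕ) ∈ Δ then a ![b * (ν - j), j] else 0 with ha'
  have hface : f - ∑ j ∈ Finset.range (ν + 1), a' j * (x ^ (b * (ν - j)) * y ^ j) ∈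
      weightedMonomialIdeal ![x, y] ![1, b] (b * ν + 1) :=
    LocalGameEFTNewton.sub_face_sum_mem_of_expansion hxy hb1 hr le_rfl hge'
  set P : (S ⧸ I)[X] := ∑ j ∈ Finset.range (ν + 1), Polynomial.monomial j (Ideal.Quotient.mk I (a' j)) with hP
  have hPcoeff : ∀ k ∈ Finset.range (ν + 1), P.coeff k = Ideal.Quotient.mk I (a' k) := fun k hk => by
    rw [hP, Polynomial.finsetSum_coeff]
    simp_rw [Polynomial.coeff_monomial]
    rw [Finset.sum_eq_single k (fun k' _ hk' => if_neg hk') (fun h => absurd hk h), if_pos rfl]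
  have hdeg : P.natDegree ≤ ν := by
    refine Polynomial.natDegree_sum_le_of_forall_le _ _ fun k hk => ?_
    exact (Polynomial.natDegree_monomial_le _).trans (Nat.lt_succ_iff.mp (Finset.mem_range.mp hk))
  have ha'ν : a' ν = a ![0, ν] := by
    have h0 : (![b * (ν - ν), ν] : Fin 2 → ℕ) = ![0, ν] := by rw [Nat.sub_self, mul_zero]
    simp only [ha', h0, if_pos he0]
  have hres_ne : ∀ {s : S}, IsUnit s → Ideal.Quotient.mk I s ≠ 0 := fun {s} hs h0 => by
    rw [Ideal.Quotient.eq_zero_iff_mem, hu] at h0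
    exact (mem_maximalIdeal _).mp h0 hs
  have hunit_of : ∀ {s : S}, Ideal.Quotient.mk I s ≠ 0 → IsUnit s := fun {s} hs => by
    by_contra hns
    exact hs (Ideal.Quotient.eq_zero_iff_mem.mpr (by rw [hu]; exact (mem_maximalIdeal _).mpr hns))
  have hPν : P.coeff ν ≠ 0 := by
    rw [hPcoeff ν (Finset.self_mem_range_succ ν), ha'ν]
    exact hres_ne (hunit _ he0)
  -- `P` is not `c (s - λ)^ν`: otherwise K5d steepens, contradicting `hst`
  have hPpow : ¬ ∃ c l : S ⧸ I, P = C c * (X - C l) ^ ν := by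
    rintro ⟨cb, lb, hcl⟩
    obtain ⟨c, rfl⟩ := Ideal.Quotient.mk_surjective cb
    obtain ⟨lam, rfl⟩ := Ideal.Quotient.mk_surjective lb
    have hcoeffk : ∀ k ∈ Finset.range (ν + 1),
        P.coeff k = Ideal.Quotient.mk I c * (ν.choose k : S ⧸ I) * (-Ideal.Quotient.mk I lam) ^ (ν - k) := by
      intro k _
      rw [hcl, Polynomial.coeff_C_mul, sub_eq_add_neg, ← Polynomial.C_neg, Polynomial.coeff_X_add_C_pow]
      ring
    have hres : ∀ j ∈ Finset.range (ν + 1), a' j - c * (ν.choose j : S) * (-lam) ^ (ν - j) ∈ maximalIdeal S := by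
      intro j hj
      rw [← hu, ← Ideal.Quotient.eq_zero_iff_mem, map_sub, ← hPcoeff j hj, hcoeffk j hj, map_mul, map_mul, map_pow,
        map_neg, map_natCast, sub_self]
    have hcP : P.coeff ν = Ideal.Quotient.mk I c := by
      rw [hcoeffk ν (Finset.self_mem_range_succ ν), Nat.choose_self, Nat.cast_one, mul_one, Nat.sub_self, pow_zero,
        mul_one]
    have hcunit : IsUnit c := hunit_of (hcP ▸ hPν)
    exact hst ⟨c, lam, hcunit, LocalGameEFTSteepening.sub_mul_steepen_pow_mem_of_face hxy hb1 hface hres⟩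
  -- the face polynomial of the transform is the homogenisation of `P`; K4a + K7a
  have hf : f = ∑ α ∈ Δ, a α * ∏ i, ![x, y] i ^ α i + (f - ∑ α ∈ Δ, a α * ∏ i, ![x, y] i ^ α i) :=
    (add_sub_cancel _ f).symm
  have hρ := rho_transform_eq_face hd hxy hb1 Δ a hN hr hge (Nat.lt_succ_self _)
  letI : Field (S ⧸ I) := Ideal.Quotient.field I
  refine LocalGameEFTPointMove.pointMove_iotaOrd_lt_of_face ![x, y] ![1, b] hu hd hw Δ a (b * ν) hN hr hge
    (Nat.lt_succ_self _) hf ν fun 𝔫' _ hV' => ?_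
  rw [hρ]
  refine LocalGameEFTFace.algebraMap_face_notMem_pow hb1 hν1 hdeg hPν hPpow rfl 𝔫' fun hle => hV' ?_
  rw [Ideal.span_le]
  rintro _ ⟨i, rfl⟩
  fin_cases i
  · exact hle (Ideal.subset_span (by simp))
  · exact hle (Ideal.subset_span (by simp))

end Drops

end LocalGameEFTDimTwo

end Summit.ResolutionOfSingularities.ResolutionOfSingularities.Theorems

end
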